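import Literature.Analysis.FluidPDE.AxisymmetricEuler
import Literature.Analysis.FluidPDE.ChenHouBlowup
import Literature.Analysis.FluidPDE.ChenHou2021HolderBoundaryBlowup
import Literature.Analysis.FluidPDE.MeridianReduction
import Literature.Analysis.FluidPDE.ZlatosTorusGradientGrowth
import HarnessLib

/-!
# Kiselev–Park–Yao 2022: infinite-in-time small-scale formation for the inviscid 2D Boussinesq
# equation WITHOUT a wall (torus, Thm 1.3) and WITH a wall (strip, Thm 1.4), and for 3D
# axisymmetric Euler with swirl in an annular cylinder (Thm 1.7) — the printed theorems as named facts

A. Kiselev, J. Park, Y. Yao, *Small scale formation for the 2D Boussinesq equation*, Anal. PDE **18**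
(2025) 171–198 = arXiv:2211.05070 [KiselevParkYao2022] (`pNNNN Lk` = chunk/line of the held arXiv
rendering `paper:arxiv-2211.05070`).

HONEST FRAMING (cell ns-blowup, profile zone Z8 «Hou–Luo corner analogue WITHOUT boundary»; D-0081
§A1 zone literature). These are INFINITE-TIME GROWTH theorems (algebraic lower bounds on the lifespan),
"far from a finite-time blow up" (p0005 L13, p0006 L46). They are the printed two-sided prior of the
zone's object M (the 2D Boussinesq 4-fold mirror class: `t^{1/2}` WITHOUT the wall, Thm 1.3, against
`t²`/`t³` WITH the wall, Thm 1.4) and, for object L, the only theorem in print for 3D axisymmetric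
Euler data whose swirl `u^θ` is EVEN in `z` (Thm 1.7 — WITH walls at `r = π, 2π`). WHAT THIS IS NOT:
not Navier–Stokes; nothing here asserts or denies blow-up; Theorem 1.1 (viscous `ν > 0`, no density
diffusion: `limsup_{t→∞} t^{−s/10}‖ρ(t)‖_{Ḣ^s(ℝ²)} = ∞`, `s ≥ 1`, p0004 L3) is recorded here and NOT
typed.

## The printed statements

Setting (p0003 L1–L9): `ρ_t + u·∇ρ = 0`, `u_t + u·∇u = −∇p − ρ e₂ + νΔu`, `∇·u = 0` on `Ω = ℝ²`,
`𝕋² = (−π, π]²` or the strip `𝕋 × [0, π]` (periodic in `x₁`); for `ν = 0` on the strip the no-flow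
condition `u·n = 0`. Inviscid vorticity form (p0004): `ω_t + u·∇ω = −∂₁ρ`, `ω = ∂₁u₂ − ∂₂u₁`,
`u = ∇^⊥(−Δ)⁻¹ω`.

**Theorem 1.3** (p0005 L3–L10). "Let `ρ₀ ∈ C^∞(𝕋²)` be odd in `x₂` and even in `x₁`, and
`ω₀ ∈ C^∞(𝕋²)` be odd in both `x₁` and `x₂`. Assume `ρ₀ ≥ 0` on `{0}×[0,π]` with
`k₀ := sup_{x₂∈[0,π]} ρ₀(0,x₂) > 0`, and `ρ₀ ≤ 0` on `{π}×[0,π]`. Then there exists some constant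
`c(ρ₀,ω₀) > 0`, such that the corresponding solution `(ρ,ω)` to (1.2) satisfies
`sup_{τ∈[0,t]} ‖∇ρ(τ)‖_{L^∞(𝕋²)} > c(ρ₀,ω₀) t^{1/2}` for all `t ∈ [0,T)`, where `T` is the lifespan of
the smooth solution `(ρ,ω)`."

**Theorem 1.4** (p0005 L15–L33). "Let `Ω = 𝕋 × [0,π]`. Let `ρ₀ ∈ C^∞(Ω)` be even in `x₁`, and
`ω₀ ∈ C^∞(Ω)` be odd in `x₁`. Assume that there exists `k₀ > 0` such that `ρ₀ ≥ k₀ > 0` on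
`{0}×[0,π]`, and `ρ₀ ≤ 0` on `{π}×[0,π]`. Then there exist some constants `T₀(ρ₀,ω₀) ≥ 0` and
`c(ρ₀,ω₀) > 0`, such that the corresponding solution `(ρ,ω)` to (1.2) satisfies
`‖ω(t)‖_{L^p(Ω)} ≥ c t^{3−2/p}` for all `p ∈ [1,∞]`, `t ∈ [T₀,T)`, `‖u(t)‖_{L^∞(Ω)} ≥ c t` for all
`t ∈ [T₀,T)`, and `sup_{τ∈[0,t]} ‖∇ρ(τ)‖_{L^∞(Ω)} > c t²` for all `t ∈ [0,T)`, where `T` is the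
lifespan of the smooth solution `(ρ,ω)`. In particular, if `∫_{[0,π]×[0,π]} ω₀ dx ≥ 0`, then `T₀ = 0`
in all the estimates above."

**Theorem 1.7** (p0006 L25–L46). Domain: "a (not rotating) Taylor–Couette tank
`Ω = {(r,θ,z) : r ∈ [π, 2π], θ ∈ 𝕋, z ∈ 𝕋}` with no-penetration boundary condition at `r = π, 2π`
and periodic boundary conditions in `z`". "Let `u^θ₀ ∈ C^∞(Ω)` be even in `z`, and `ω^θ₀ ∈ C^∞(Ω)` be
odd in `z`. Assume that there exists `k₀ > 0` such that `u^θ₀ ≥ k₀ > 0` on `z = π`, and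
`|u^θ₀| ≤ k₀/8` on `z = 0`. Then there exist some constants `T₀(u₀) ≥ 0` and `c(u₀) > 0`, such that
the corresponding solution satisfies `‖ω^θ(t)‖_{L^p(Ω)} ≥ c t^{3−2/p}` for all `p ∈ [1,∞]`,
`t ∈ [T₀,T)` and `‖u(t)‖_{L^∞(Ω)} ≥ c t` for all `t ∈ [T₀,T)`, where `T` is the lifespan of the smooth
solution. In particular, if `∫₀^π ∫_π^{2π} ω₀^θ dr dz ≥ 0`, then `T₀ = 0` in both estimates above."
(p0006 L47: "our setting is almost the same as the Hou–Luo scenario, except that we replace the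
cylinder by an annular cylinder".)

## Rendering (velocity form, functions on `ℝ²` / `ℝ³` periodic in the torus directions)

* A smooth solution on the torus is a jointly smooth classical solution `(u, p, ρ)` on `ℝ²`, all three
  `2π`-periodic in both coordinates (`IsDoublyPeriodic (2π)`), of the Euler system with body force
  `−ρ e₂` (the tree's `IsClassicalEulerSolutionOn`, `e₂ = eY`) coupled to the transport of `ρ`
  (`IsClassicalBoussinesqOnPlane`). On the strip the Euler part is the tree's
  `IsClassicalEulerOnDomain` on the open strip `{0 < x₂ < π}` with the no-flow walls (`kpyStrip`,
  `kpyStripNormal`), periodic in `x₁`, smooth up to the walls. In 3D the annulus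
  `{π < r < 2π}` with normals `∓e_r` (`kpyAnnulus`, `kpyAnnulusNormal`), axisymmetric, `2π`-periodic in
  `z`, smooth up to the walls.
* Parities: `IsOddInCoord i` / `IsEvenInCoord i` (reflection of the `i`-th coordinate, `flipCoord`).
  The print states the parity of the vorticity `ω₀` of the Biot–Savart (mean-zero / zero-flux)
  velocity; for smooth periodic divergence-free fields this is EQUIVALENT to the component parities of
  the velocity used below (Thm 1.3: `u₁` odd in `x₁` and even in `x₂`, `u₂` even in `x₁` and odd in
  `x₂` ⇔ `ω` odd in both variables and `u` mean-zero; Thm 1.4: `u₁` odd, `u₂` even in `x₁` ⇔ `ω` odd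
  in `x₁` and zero flux), so the hypotheses below IMPLY the printed ones. In 3D the printed class
  ("`u^θ₀` even, `ω^θ₀` odd in `z`") is rendered by reflection-equivariance of the velocity under
  `z ↦ −z` (`IsMirrorSymmetricZ`: `u(Rx) = R u(x)`), which gives `u^θ`, `u^r` even and `u^z`, `ω^θ`
  odd in `z` (`IsMirrorSymmetricZ.swirlVelocity_reflectZ`, `.axial_reflectZ` proved) and fixes the
  axial flux to zero.
* "The corresponding solution … on its lifespan": smooth solutions are unique (the paper itself
  uses this, p0007 L5), so the print applies to EVERY smooth solution on any `[0, T)` with the given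
  data; the constants `c`, `T₀` are chosen from the data BEFORE `T` and the solution, as printed.
* `sup_{τ≤t} ‖∇ρ(τ)‖_∞ > a` is rendered by its consequence "some `τ ∈ [0,t]` and some point have
  `‖∇ρ(τ,x)‖ > a`" (definition of `sup`); `‖ω(t)‖_{L^∞} ≥ a` by "every `M < a` is exceeded by
  `|ω(t,x)|` at some point of the open domain" (continuity up to the boundary); only the `p = ∞`
  vorticity clauses of Thms 1.4/1.7 are typed (the `L^p` family, `1 ≤ p < ∞`, is recorded above).
  Every typed conclusion is IMPLIED BY the print; every typed hypothesis set IMPLIES the printed one.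
-/

noncomputable section

open Set Function Filter Topology MeasureTheory TopologicalSpace WithLp
open scoped Real RealInnerProductSpace NNReal ENNReal ContDiff

namespace Literature.Analysis.FluidPDE

/-! ### Periodicity and coordinate parities on `ℝ²` -/

/-- Periodicity with period `L` in the `i`-th coordinate direction: `v (x + L eᵢ) = v x`
(functions on `𝕋 × [0,π]` are `2π`-periodic in `x₁`, p0003 L9). [cite: KiselevParkYao2022, §1 setting (arXiv:2211.05070 p0003 L9)] -/
def IsPeriodicInCoord {F : Sort*} (i : Fin 2) (L : ℝ) (v : EuclideanSpace ℝ (Fin 2) → F) : Prop :=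
  ∀ x : EuclideanSpace ℝ (Fin 2), v (x + L • EuclideanSpace.single i (1 : ℝ)) = v x

/-- Periodicity with period `L` in BOTH coordinate directions (functions on the torus
`𝕋² = (−π, π]²` are the case `L = 2π`, p0003 L9). [cite: KiselevParkYao2022, §1 setting (arXiv:2211.05070 p0003 L9)] -/
def IsDoublyPeriodic {F : Sort*} (L : ℝ) (v : EuclideanSpace ℝ (Fin 2) → F) : Prop :=
  ∀ i : Fin 2, IsPeriodicInCoord i L v

/-- Zlatoš's `(2𝕋)²`-periodicity `IsTwoPeriodic` is `IsDoublyPeriodic 2` (same definition, period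
`2`). [cite: Zlatos2015, §1 (arXiv:1310.6128 p0003)] -/
theorem isTwoPeriodic_iff_isDoublyPeriodic {F : Sort*} (v : EuclideanSpace ℝ (Fin 2) → F) :
    IsTwoPeriodic v ↔ IsDoublyPeriodic 2 v :=
  ⟨fun h i x => h x i, fun h x i => h i x⟩

/-- Reflection of the `i`-th coordinate: `flipCoord i x` has `i`-th coordinate `−xᵢ` and the other
coordinate unchanged ("odd/even in `x₁`", "in `x₂`", Thms 1.3/1.4). (The same map as the QFT corner's
`CCHS2024.reflectCoord`, not imported here to keep the FluidPDE import cone small.)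
[cite: KiselevParkYao2022, Theorem 1.3 (arXiv:2211.05070 p0005 L3)] -/
def flipCoord (i : Fin 2) (x : EuclideanSpace ℝ (Fin 2)) : EuclideanSpace ℝ (Fin 2) :=
  x - (2 * x i) • EuclideanSpace.single i (1 : ℝ)

/-- The flipped coordinate changes sign (unfolding of the printed reflection). [cite: KiselevParkYao2022, Theorem 1.3 parity hypotheses (arXiv:2211.05070 p0005 L3)] -/
@[simp] theorem flipCoord_apply_self (i : Fin 2) (x : EuclideanSpace ℝ (Fin 2)) :
    flipCoord i x i = -x i := by
  simp [flipCoord]; ring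

/-- The other coordinate is unchanged (unfolding of the printed reflection). [cite: KiselevParkYao2022, Theorem 1.3 parity hypotheses (arXiv:2211.05070 p0005 L3)] -/
@[simp] theorem flipCoord_apply_of_ne {i j : Fin 2} (h : j ≠ i) (x : EuclideanSpace ℝ (Fin 2)) :
    flipCoord i x j = x j := by
  simp [flipCoord, h]

/-- `flipCoord i` is an involution. [cite: KiselevParkYao2022, Theorem 1.3 parity hypotheses (arXiv:2211.05070 p0005 L3)] -/
@[simp] theorem flipCoord_flipCoord (i : Fin 2) (x : EuclideanSpace ℝ (Fin 2)) :
    flipCoord i (flipCoord i x) = x := by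
  ext j
  by_cases h : j = i
  · subst h; simp
  · simp [h]

/-- A point is fixed by `flipCoord i` iff its `i`-th coordinate vanishes (the reflection axis).
[cite: KiselevParkYao2022, Theorem 1.3 parity hypotheses (arXiv:2211.05070 p0005 L3)] -/
theorem flipCoord_eq_self_iff (i : Fin 2) (x : EuclideanSpace ℝ (Fin 2)) :
    flipCoord i x = x ↔ x i = 0 := by
  constructor
  · intro h
    have := congrArg (fun y => y i) h
    simp only [flipCoord_apply_self] at this
    linarith
  · intro h
    ext j
    by_cases hj : j = i
    · subst hj; simp [h]
    · simp [hj]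

/-- `f` is EVEN in the `i`-th coordinate: `f (flipCoord i x) = f x`. [cite: KiselevParkYao2022, Theorem 1.3 (arXiv:2211.05070 p0005 L3)] -/
def IsEvenInCoord {F : Sort*} (i : Fin 2) (f : EuclideanSpace ℝ (Fin 2) → F) : Prop :=
  ∀ x, f (flipCoord i x) = f x

/-- `f` is ODD in the `i`-th coordinate: `f (flipCoord i x) = −f x`. [cite: KiselevParkYao2022, Theorem 1.3 (arXiv:2211.05070 p0005 L3)] -/
def IsOddInCoord {F : Type*} [Neg F] (i : Fin 2) (f : EuclideanSpace ℝ (Fin 2) → F) : Prop :=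
  ∀ x, f (flipCoord i x) = -f x

/-- A real function odd in the `i`-th coordinate vanishes on the reflection axis `{xᵢ = 0}`
(why the print adds "`ρ₀ = 0` on the `x₂`-axis" only as a remark, p0003 footnote; and why the
mirror-class density of Thm 1.3 vanishes on the symmetry line `{x₂ = 0}`). [cite: KiselevParkYao2022, §1.1 assumptions (A2) footnote (arXiv:2211.05070 p0003)] -/
theorem IsOddInCoord.eq_zero_of_apply_eq_zero {i : Fin 2} {f : EuclideanSpace ℝ (Fin 2) → ℝ}
    (hf : IsOddInCoord i f) {x : EuclideanSpace ℝ (Fin 2)} (hx : x i = 0) : f x = 0 := by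
  have h := hf x
  rw [(flipCoord_eq_self_iff i x).2 hx] at h
  linarith

/-! ### The 2D Boussinesq system on the whole plane / torus (velocity form) -/

/-- **Smooth solutions of the inviscid 2D Boussinesq system on `ℝ²`** on the time set `S`, in
velocity form: `(u, p)` is a jointly smooth classical Euler solution with body force `−ρ e₂`
(`IsClassicalEulerSolutionOn`, `e₂ = eY`), `ρ` is jointly smooth, and `ρ_t + u·∇ρ = 0`. Torus
solutions are the doubly `2π`-periodic ones (periodicity is imposed separately). Equivalent for smooth
fields to the printed vorticity form `ω_t + u·∇ω = −∂₁ρ`, `ω = ∂₁u₂ − ∂₂u₁ = curl2 u`.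
[cite: KiselevParkYao2022, §1 eq. (1.1) and §1.2 eq. (1.2) (arXiv:2211.05070 p0003 L3–L9, p0004)] -/
structure IsClassicalBoussinesqOnPlane (S : Set ℝ)
    (u : ℝ → EuclideanSpace ℝ (Fin 2) → EuclideanSpace ℝ (Fin 2))
    (p ρ : ℝ → EuclideanSpace ℝ (Fin 2) → ℝ) : Prop where
  /-- Euler with buoyancy `−ρ e₂`, jointly smooth on `S × ℝ²`. -/
  euler : IsClassicalEulerSolutionOn S (fun t x => -(ρ t x) • eY) u p
  /-- `ρ` is jointly smooth on `S × ℝ²`. -/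
  smooth_density : IsSmoothSpaceTimeOn S ρ
  /-- Transport of the density: `ρ_t + u·∇ρ = 0` on `S × ℝ²`. -/
  transport : ∀ t ∈ S, ∀ x, timeDerivWithin S ρ t x + convect (u t) (ρ t) x = 0

/-! ### The strip `𝕋 × [0, π]` with no-flow walls -/

/-- The open strip `{0 < x₂ < π}` (index `1` = `x₂`), the interior of the printed `Ω = 𝕋 × [0,π]`;
the walls are `{x₂ = 0}` and `{x₂ = π}`. [cite: KiselevParkYao2022, §1 setting and Theorem 1.4 (arXiv:2211.05070 p0003 L9, p0005 L15)] -/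
def kpyStrip : Opens (EuclideanSpace ℝ (Fin 2)) :=
  ⟨{x | 0 < x 1 ∧ x 1 < π}, (isOpen_lt continuous_const (EuclideanSpace.proj (1 : Fin 2)).continuous).inter
    (isOpen_lt (EuclideanSpace.proj (1 : Fin 2)).continuous continuous_const)⟩

/-- Membership in the strip. [cite: KiselevParkYao2022, Theorem 1.4 (arXiv:2211.05070 p0005 L15)] -/
@[simp] theorem mem_kpyStrip {x : EuclideanSpace ℝ (Fin 2)} : x ∈ kpyStrip ↔ 0 < x 1 ∧ x 1 < π :=
  Iff.rfl

/-- Outward normal field of the strip: `−e₂` near the lower wall, `+e₂` near the upper wall (only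
its values on the walls matter). [cite: KiselevParkYao2022, §1 setting: "no-flow boundary condition u·n = 0 if ν = 0" (arXiv:2211.05070 p0003 L9)] -/
def kpyStripNormal (x : EuclideanSpace ℝ (Fin 2)) : EuclideanSpace ℝ (Fin 2) :=
  if x 1 < π / 2 then -eY else eY

/-- The no-flow condition against `kpyStripNormal` is the vanishing of the normal velocity `u₂`.
[cite: KiselevParkYao2022, §1 setting (arXiv:2211.05070 p0003 L9)] -/
theorem inner_kpyStripNormal_eq_zero_iff (x w : EuclideanSpace ℝ (Fin 2)) :
    ⟪w, kpyStripNormal x⟫ = 0 ↔ w 1 = 0 := by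
  unfold kpyStripNormal
  split_ifs <;> simp [eY, EuclideanSpace.inner_single_right, inner_neg_right]

/-- **Classical solutions of the inviscid 2D Boussinesq system on the strip with no-flow walls** on
the time set `S`: `(u, p)` is a classical Euler solution on the open strip with body force `−ρ e₂`
and `u·n = 0` on both walls (`IsClassicalEulerOnDomain`, `C¹` up to the walls), `ρ` is `C¹` on
`S × closure(strip)`, and `ρ_t + u·∇ρ = 0` in the strip. Periodicity in `x₁` and smoothness up to the
walls are imposed separately. [cite: KiselevParkYao2022, §1 setting and Theorem 1.4 (arXiv:2211.05070 p0003 L3–L9, p0005 L15)] -/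
structure IsClassicalBoussinesqOnStrip (S : Set ℝ)
    (u : ℝ → EuclideanSpace ℝ (Fin 2) → EuclideanSpace ℝ (Fin 2))
    (p ρ : ℝ → EuclideanSpace ℝ (Fin 2) → ℝ) : Prop where
  /-- Euler with buoyancy `−ρ e₂` and the no-flow walls. -/
  euler : IsClassicalEulerOnDomain S kpyStrip kpyStripNormal (fun t x => -(ρ t x) • eY) u p
  /-- `ρ` is `C¹` on `S × closure(strip)`. -/
  smooth_density : ContDiffOn ℝ 1 (uncurry ρ)
    (S ×ˢ closure (kpyStrip : Set (EuclideanSpace ℝ (Fin 2))))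
  /-- Transport of the density in the strip. -/
  transport : ∀ t ∈ S, ∀ x ∈ kpyStrip, timeDerivWithin S ρ t x + convect (u t) (ρ t) x = 0

/-- The closed square `[0,π] × [0,π]` over which Thm 1.4 integrates `ω₀` for its `T₀ = 0` clause.
[cite: KiselevParkYao2022, Theorem 1.4 last sentence (arXiv:2211.05070 p0005 L33)] -/
def kpySquare : Set (EuclideanSpace ℝ (Fin 2)) :=
  {x | x 0 ∈ Icc 0 π ∧ x 1 ∈ Icc 0 π}

/-! ### The annular cylinder of Theorem 1.7 and the mirror class in `z` -/

/-- The open annulus `{π < r < 2π}` about the axis (with `2π`-periodicity in `z` imposed separately):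
the interior of the printed Taylor–Couette tank `r ∈ [π, 2π]`, `z ∈ 𝕋`. [cite: KiselevParkYao2022, eq. (1.10) (arXiv:2211.05070 p0006 L37–L41)] -/
def kpyAnnulus : Opens (EuclideanSpace ℝ (Fin 3)) :=
  ⟨{x | π < cylRadius x ∧ cylRadius x < 2 * π},
    (isOpen_lt continuous_const continuous_cylRadius).inter
      (isOpen_lt continuous_cylRadius continuous_const)⟩

/-- Membership in the annulus. [cite: KiselevParkYao2022, eq. (1.10) (arXiv:2211.05070 p0006 L37–L41)] -/
@[simp] theorem mem_kpyAnnulus {x : EuclideanSpace ℝ (Fin 3)} :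
    x ∈ kpyAnnulus ↔ π < cylRadius x ∧ cylRadius x < 2 * π :=
  Iff.rfl

/-- Outward normal field of the annulus: `−e_r` near the inner wall `r = π`, `+e_r` near the outer
wall `r = 2π` ("no-penetration boundary condition at `r = π, 2π`"). [cite: KiselevParkYao2022, eq. (1.10) (arXiv:2211.05070 p0006 L41)] -/
def kpyAnnulusNormal (x : EuclideanSpace ℝ (Fin 3)) : EuclideanSpace ℝ (Fin 3) :=
  if cylRadius x < 3 * π / 2 then -eR x else eR x

/-- The no-penetration condition against `kpyAnnulusNormal` is the vanishing of the radial velocity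
component `u^r = ⟪u, e_r⟫`. [cite: KiselevParkYao2022, eq. (1.10) (arXiv:2211.05070 p0006 L41)] -/
theorem inner_kpyAnnulusNormal_eq_zero_iff (u : EuclideanSpace ℝ (Fin 3) → EuclideanSpace ℝ (Fin 3))
    (x : EuclideanSpace ℝ (Fin 3)) :
    ⟪u x, kpyAnnulusNormal x⟫ = 0 ↔ radialVelocity u x = 0 := by
  unfold kpyAnnulusNormal radialVelocity
  split_ifs <;> simp [inner_neg_right]

/-- The reflection `z ↦ −z` across the plane `{z = 0}`: `reflectZ x = (x₀, x₁, −x₂)` (the case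
`j = 2` of the QFT corner's `reflectCoord3`, not imported here; the printed `dr dz`-integral below uses
the tree's `meridianPoint (r, z) = (r, 0, z)`).
[cite: KiselevParkYao2022, Theorem 1.7: "u^θ₀ even in z, ω^θ₀ odd in z" (arXiv:2211.05070 p0006 L43)] -/
def reflectZ (x : EuclideanSpace ℝ (Fin 3)) : EuclideanSpace ℝ (Fin 3) :=
  x - (2 * x 2) • eZ

/-- `reflectZ` fixes `x₀`. [cite: KiselevParkYao2022, Theorem 1.7 parity hypotheses (arXiv:2211.05070 p0006 L43)] -/
@[simp] theorem reflectZ_apply_zero (x : EuclideanSpace ℝ (Fin 3)) : reflectZ x 0 = x 0 := by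
  simp [reflectZ, eZ]

/-- `reflectZ` fixes `x₁`. [cite: KiselevParkYao2022, Theorem 1.7 parity hypotheses (arXiv:2211.05070 p0006 L43)] -/
@[simp] theorem reflectZ_apply_one (x : EuclideanSpace ℝ (Fin 3)) : reflectZ x 1 = x 1 := by
  simp [reflectZ, eZ]

/-- `reflectZ` negates `x₂ = z`. [cite: KiselevParkYao2022, Theorem 1.7 parity hypotheses (arXiv:2211.05070 p0006 L43)] -/
@[simp] theorem reflectZ_apply_two (x : EuclideanSpace ℝ (Fin 3)) : reflectZ x 2 = -x 2 := by
  simp [reflectZ, eZ]; ring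

/-- `reflectZ` is an involution. [cite: KiselevParkYao2022, Theorem 1.7 parity hypotheses (arXiv:2211.05070 p0006 L43)] -/
@[simp] theorem reflectZ_reflectZ (x : EuclideanSpace ℝ (Fin 3)) : reflectZ (reflectZ x) = x := by
  ext i; fin_cases i <;> simp

/-- The reflection preserves the distance to the axis. [cite: KiselevParkYao2022, Theorem 1.7 parity hypotheses (arXiv:2211.05070 p0006 L43)] -/
@[simp] theorem cylRadius_reflectZ (x : EuclideanSpace ℝ (Fin 3)) :
    cylRadius (reflectZ x) = cylRadius x := by
  simp [cylRadius]

/-- The reflection fixes the angular frame vector (which has no `z`-component and depends on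
`x₀, x₁` only). [cite: KiselevParkYao2022, Theorem 1.7 parity hypotheses (arXiv:2211.05070 p0006 L43)] -/
@[simp] theorem eTheta_reflectZ (x : EuclideanSpace ℝ (Fin 3)) : eTheta (reflectZ x) = eTheta x := by
  simp [eTheta]

/-- **Mirror symmetry in `z`** (the parity class of Theorem 1.7, "CLASS E" of the zone sheet): the
velocity field is equivariant under the reflection `z ↦ −z`, `v (Rx) = R (v x)` — equivalently
`v^r`, `v^θ` are even and `v^z` is odd in `z` (hence `ω^θ = ∂_z v^r − ∂_r v^z` is odd), the symmetry
of a head-on collision of two mirror-image configurations. [cite: KiselevParkYao2022, Theorem 1.7 (arXiv:2211.05070 p0006 L43)] -/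
def IsMirrorSymmetricZ (v : EuclideanSpace ℝ (Fin 3) → EuclideanSpace ℝ (Fin 3)) : Prop :=
  ∀ x, v (reflectZ x) = reflectZ (v x)

/-- In the mirror class the swirl velocity `u^θ = ⟪v, e_θ⟫` is EVEN in `z` (the printed hypothesis
"`u^θ₀` even in `z`"). [cite: KiselevParkYao2022, Theorem 1.7 (arXiv:2211.05070 p0006 L43)] -/
theorem IsMirrorSymmetricZ.swirlVelocity_reflectZ {v : EuclideanSpace ℝ (Fin 3) → EuclideanSpace ℝ (Fin 3)}
    (hv : IsMirrorSymmetricZ v) (x : EuclideanSpace ℝ (Fin 3)) :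
    swirlVelocity v (reflectZ x) = swirlVelocity v x := by
  rw [swirlVelocity, swirlVelocity, hv x, eTheta_reflectZ]
  simp only [eTheta, PiLp.inner_apply, RCLike.inner_apply, conj_trivial, Fin.sum_univ_three,
    PiLp.smul_apply, smul_eq_mul, reflectZ_apply_zero, reflectZ_apply_one, reflectZ_apply_two,
    Matrix.cons_val_zero, Matrix.cons_val_one, Matrix.cons_val_two, Matrix.head_cons,
    Matrix.tail_cons]
  ring

/-- In the mirror class the axial velocity `u^z` is ODD in `z`; in particular it vanishes on the
mirror plane `{z = 0}` (zero axial flux through the plane). [cite: KiselevParkYao2022, Theorem 1.7 (arXiv:2211.05070 p0006 L43)] -/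
theorem IsMirrorSymmetricZ.axial_reflectZ {v : EuclideanSpace ℝ (Fin 3) → EuclideanSpace ℝ (Fin 3)}
    (hv : IsMirrorSymmetricZ v) (x : EuclideanSpace ℝ (Fin 3)) : v (reflectZ x) 2 = -v x 2 := by
  rw [hv x, reflectZ_apply_two]

/-- On the mirror plane `{z = 0}` a mirror-symmetric field has no axial component.
[cite: KiselevParkYao2022, Theorem 1.7 (arXiv:2211.05070 p0006 L43)] -/
theorem IsMirrorSymmetricZ.axial_eq_zero_of_plane {v : EuclideanSpace ℝ (Fin 3) → EuclideanSpace ℝ (Fin 3)}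
    (hv : IsMirrorSymmetricZ v) {x : EuclideanSpace ℝ (Fin 3)} (hx : x 2 = 0) : v x 2 = 0 := by
  have hfix : reflectZ x = x := by
    ext i; fin_cases i <;> simp [hx]
  have h := hv.axial_reflectZ x
  rw [hfix] at h
  linarith

/-- The zero field is (trivially) mirror-symmetric — non-vacuity of the printed class predicate.
[cite: KiselevParkYao2022, Theorem 1.7 parity hypotheses (arXiv:2211.05070 p0006 L43)] -/
theorem isMirrorSymmetricZ_zero : IsMirrorSymmetricZ (0 : EuclideanSpace ℝ (Fin 3) → EuclideanSpace ℝ (Fin 3)) := by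
  intro x
  ext i; fin_cases i <;> simp

/-! ### The named facts -/

/-- **Kiselev–Park–Yao 2022, Theorem 1.3 (inviscid 2D Boussinesq on the torus: growth `≳ t^{1/2}`
of `‖∇ρ‖_∞` in the 4-fold mirror class, NO wall).** Rendering (module docstring): for all data
`u₀`, `ρ₀` with `ρ₀` odd in `x₂` and even in `x₁`, the velocity components in the class
`u₁` odd in `x₁`/even in `x₂`, `u₂` even in `x₁`/odd in `x₂` (⇔ `ω₀` odd in both variables,
Biot–Savart velocity), `ρ₀ ≥ 0` on `{0}×[0,π]`, `ρ₀ > 0` somewhere there, `ρ₀ ≤ 0` on `{π}×[0,π]`,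
there is `c > 0` such that EVERY jointly smooth, doubly `2π`-periodic Boussinesq solution
`(u, p, ρ)` on `[0, T)` (any `T`) with `u(0) = u₀`, `ρ(0) = ρ₀` satisfies: for every `t < T` some
`τ ∈ [0, t]` and some point `x` have `‖∇ρ(τ, x)‖ > c √t`. [cite: KiselevParkYao2022, Theorem 1.3 (arXiv:2211.05070 p0005 L3–L10)] -/
def KiselevParkYao2022_torusGradientGrowth : Prop :=
  ∀ (u₀ : EuclideanSpace ℝ (Fin 2) → EuclideanSpace ℝ (Fin 2)) (ρ₀ : EuclideanSpace ℝ (Fin 2) → ℝ),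
    IsOddInCoord 1 ρ₀ → IsEvenInCoord 0 ρ₀ →
    IsOddInCoord 0 (fun x => u₀ x 0) → IsEvenInCoord 1 (fun x => u₀ x 0) →
    IsEvenInCoord 0 (fun x => u₀ x 1) → IsOddInCoord 1 (fun x => u₀ x 1) →
    (∀ x : EuclideanSpace ℝ (Fin 2), x 0 = 0 → x 1 ∈ Icc 0 π → 0 ≤ ρ₀ x) →
    (∃ x : EuclideanSpace ℝ (Fin 2), x 0 = 0 ∧ x 1 ∈ Icc 0 π ∧ 0 < ρ₀ x) →
    (∀ x : EuclideanSpace ℝ (Fin 2), x 0 = π → x 1 ∈ Icc 0 π → ρ₀ x ≤ 0) →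
    ∃ c : ℝ, 0 < c ∧
      ∀ (T : ℝ) (u : ℝ → EuclideanSpace ℝ (Fin 2) → EuclideanSpace ℝ (Fin 2))
        (p ρ : ℝ → EuclideanSpace ℝ (Fin 2) → ℝ),
        IsClassicalBoussinesqOnPlane (Ico 0 T) u p ρ →
        (∀ t ∈ Ico 0 T, IsDoublyPeriodic (2 * π) (u t) ∧ IsDoublyPeriodic (2 * π) (p t) ∧
          IsDoublyPeriodic (2 * π) (ρ t)) →
        u 0 = u₀ → ρ 0 = ρ₀ →
        ∀ t ∈ Ico 0 T, ∃ τ ∈ Icc 0 t, ∃ x : EuclideanSpace ℝ (Fin 2),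
          c * Real.sqrt t < ‖fderiv ℝ (ρ τ) x‖

/-- **Kiselev–Park–Yao 2022, Theorem 1.4 (inviscid 2D Boussinesq on the strip `𝕋 × [0,π]` WITH
no-flow walls: `‖ω(t)‖_∞ ≥ c t³`, `‖u(t)‖_∞ ≥ c t` after a waiting time, `sup_{τ≤t}‖∇ρ(τ)‖_∞ > c t²`;
`T₀ = 0` if `∫_{[0,π]²} ω₀ ≥ 0`).** Rendering (module docstring): for all data with `ρ₀` even in `x₁`,
`u₁` odd and `u₂` even in `x₁` (⇔ `ω₀` odd in `x₁`, zero-flux velocity) on the closed strip,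
`ρ₀ ≥ k₀ > 0` on `{0}×[0,π]` and `ρ₀ ≤ 0` on `{π}×[0,π]`, there are `T₀ ≥ 0` and `c > 0` — with
`T₀ = 0` whenever `∫_{[0,π]×[0,π]} curl2 u₀ ≥ 0` — such that EVERY solution `(u, p, ρ)` on `[0,T)`
of the strip problem (`IsClassicalBoussinesqOnStrip`), smooth up to the walls and `2π`-periodic in
`x₁`, with `u(0) = u₀`, `ρ(0) = ρ₀`, satisfies: for `T₀ ≤ t < T`, every `M < c t³` is exceeded by
`|curl2 u(t)|` at some point of the strip and every `M < c t` by `‖u(t, x)‖`; and for every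
`t < T` some `τ ∈ [0,t]` and some point of the strip have `‖∇ρ(τ, x)‖ > c t²`. (The `L^p` bounds
`‖ω(t)‖_{L^p} ≥ c t^{3−2/p}`, `1 ≤ p < ∞`, are printed and not typed.)
[cite: KiselevParkYao2022, Theorem 1.4 (arXiv:2211.05070 p0005 L15–L33)] -/
def KiselevParkYao2022_stripGrowth : Prop :=
  ∀ (u₀ : EuclideanSpace ℝ (Fin 2) → EuclideanSpace ℝ (Fin 2)) (ρ₀ : EuclideanSpace ℝ (Fin 2) → ℝ),
    (∀ x ∈ closure (kpyStrip : Set (EuclideanSpace ℝ (Fin 2))),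
      ρ₀ (flipCoord 0 x) = ρ₀ x ∧ u₀ (flipCoord 0 x) 0 = -u₀ x 0 ∧ u₀ (flipCoord 0 x) 1 = u₀ x 1) →
    (∃ k₀ : ℝ, 0 < k₀ ∧ ∀ x : EuclideanSpace ℝ (Fin 2), x 0 = 0 → x 1 ∈ Icc 0 π → k₀ ≤ ρ₀ x) →
    (∀ x : EuclideanSpace ℝ (Fin 2), x 0 = π → x 1 ∈ Icc 0 π → ρ₀ x ≤ 0) →
    ∃ T₀ c : ℝ, 0 ≤ T₀ ∧ 0 < c ∧
      ((0 ≤ ∫ x in kpySquare, curl2 u₀ x) → T₀ = 0) ∧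
      ∀ (T : ℝ) (u : ℝ → EuclideanSpace ℝ (Fin 2) → EuclideanSpace ℝ (Fin 2))
        (p ρ : ℝ → EuclideanSpace ℝ (Fin 2) → ℝ),
        IsClassicalBoussinesqOnStrip (Ico 0 T) u p ρ →
        ContDiffOn ℝ ∞ (uncurry u) (Ico 0 T ×ˢ closure (kpyStrip : Set (EuclideanSpace ℝ (Fin 2)))) →
        ContDiffOn ℝ ∞ (uncurry p) (Ico 0 T ×ˢ closure (kpyStrip : Set (EuclideanSpace ℝ (Fin 2)))) →
        ContDiffOn ℝ ∞ (uncurry ρ) (Ico 0 T ×ˢ closure (kpyStrip : Set (EuclideanSpace ℝ (Fin 2)))) →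
        (∀ t ∈ Ico 0 T, IsPeriodicInCoord 0 (2 * π) (u t) ∧ IsPeriodicInCoord 0 (2 * π) (p t) ∧
          IsPeriodicInCoord 0 (2 * π) (ρ t)) →
        u 0 = u₀ → ρ 0 = ρ₀ →
        (∀ t ∈ Ico 0 T, T₀ ≤ t →
          (∀ M : ℝ, M < c * t ^ 3 → ∃ x ∈ kpyStrip, M < |curl2 (u t) x|) ∧
          (∀ M : ℝ, M < c * t → ∃ x ∈ kpyStrip, M < ‖u t x‖)) ∧
        (∀ t ∈ Ico 0 T, ∃ τ ∈ Icc 0 t, ∃ x ∈ kpyStrip, c * t ^ 2 < ‖fderiv ℝ (ρ τ) x‖)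

/-- **Kiselev–Park–Yao 2022, Theorem 1.7 (3D axisymmetric Euler with swirl in the annular cylinder
`π ≤ r ≤ 2π`, `z ∈ 𝕋`, mirror class in `z`: `‖ω^θ(t)‖_∞ ≥ c t³` and `‖u(t)‖_∞ ≥ c t` after a waiting
time; `T₀ = 0` if `∫₀^π∫_π^{2π} ω₀^θ dr dz ≥ 0`).** Rendering (module docstring): for all data `u₀`
that are mirror-symmetric in `z` on the closed annulus (`u₀(Rx) = R u₀(x)`, giving the printed
"`u^θ₀` even, `ω^θ₀` odd in `z`" with zero axial flux) and satisfy `u^θ₀ ≥ k₀ > 0` on `{z = π}`,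
`|u^θ₀| ≤ k₀/8` on `{z = 0}`, there are `T₀ ≥ 0` and `c > 0` — with `T₀ = 0` whenever
`∫_{[π,2π]×[0,π]} ω₀^θ(r, 0, z) d(r,z) ≥ 0` — such that EVERY axisymmetric classical Euler solution
`(u, p)` (`f = 0`) on `[0,T)` in the annulus with the no-penetration walls (`IsClassicalEulerOnDomain`),
smooth up to the walls, `2π`-periodic in `z`, with `u(0) = u₀`, satisfies for `T₀ ≤ t < T`: every
`M < c t³` is exceeded by `|ω^θ(t, x)|` (`angularVorticity`) at some point of the annulus, and every
`M < c t` by `‖u(t, x)‖`. (The `L^p` bounds, `1 ≤ p < ∞`, are printed and not typed.)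
[cite: KiselevParkYao2022, Theorem 1.7 (arXiv:2211.05070 p0006 L37–L46)] -/
def KiselevParkYao2022_annulusSwirlGrowth : Prop :=
  ∀ (u₀ : EuclideanSpace ℝ (Fin 3) → EuclideanSpace ℝ (Fin 3)),
    (∀ x ∈ closure (kpyAnnulus : Set (EuclideanSpace ℝ (Fin 3))), u₀ (reflectZ x) = reflectZ (u₀ x)) →
    (∃ k₀ : ℝ, 0 < k₀ ∧
      (∀ x ∈ closure (kpyAnnulus : Set (EuclideanSpace ℝ (Fin 3))), x 2 = π →
        k₀ ≤ swirlVelocity u₀ x) ∧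
      (∀ x ∈ closure (kpyAnnulus : Set (EuclideanSpace ℝ (Fin 3))), x 2 = 0 →
        |swirlVelocity u₀ x| ≤ k₀ / 8)) →
    ∃ T₀ c : ℝ, 0 ≤ T₀ ∧ 0 < c ∧
      ((0 ≤ ∫ q in Icc π (2 * π) ×ˢ Icc 0 π, angularVorticity u₀ (meridianPoint q)) → T₀ = 0) ∧
      ∀ (T : ℝ) (u : ℝ → EuclideanSpace ℝ (Fin 3) → EuclideanSpace ℝ (Fin 3))
        (p : ℝ → EuclideanSpace ℝ (Fin 3) → ℝ),
        IsClassicalEulerOnDomain (Ico 0 T) kpyAnnulus kpyAnnulusNormal 0 u p →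
        ContDiffOn ℝ ∞ (uncurry u) (Ico 0 T ×ˢ closure (kpyAnnulus : Set (EuclideanSpace ℝ (Fin 3)))) →
        ContDiffOn ℝ ∞ (uncurry p) (Ico 0 T ×ˢ closure (kpyAnnulus : Set (EuclideanSpace ℝ (Fin 3)))) →
        (∀ t ∈ Ico 0 T, IsAxisymmetric (u t) ∧ IsAxisymmetricScalar (p t) ∧
          IsAxiallyPeriodic (2 * π) (u t) ∧ IsAxiallyPeriodic (2 * π) (p t)) →
        u 0 = u₀ →
        ∀ t ∈ Ico 0 T, T₀ ≤ t →
          (∀ M : ℝ, M < c * t ^ 3 → ∃ x ∈ kpyAnnulus, M < |angularVorticity (u t) x|) ∧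
          (∀ M : ℝ, M < c * t → ∃ x ∈ kpyAnnulus, M < ‖u t x‖)

/-! ### Readings (proved): what the facts give at once -/

/-- **Reading of Theorem 1.3: no uniform-in-time gradient bound for GLOBAL mirror-class solutions.**
If a smooth doubly periodic Boussinesq solution with Thm-1.3 data exists on `[0, ∞)` — i.e. on every
`[0, T)` — then `‖∇ρ‖` is unbounded on `[0,∞) × ℝ²`: for every `B` some time and point have
`‖∇ρ(τ, x)‖ > B` (take `t` with `c√t ≥ B`). [cite: KiselevParkYao2022, Theorem 1.3 (arXiv:2211.05070 p0005 L3–L10)] -/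
theorem KiselevParkYao2022_torusGradientGrowth.unbounded_of_global
    (h : KiselevParkYao2022_torusGradientGrowth)
    {u₀ : EuclideanSpace ℝ (Fin 2) → EuclideanSpace ℝ (Fin 2)} {ρ₀ : EuclideanSpace ℝ (Fin 2) → ℝ}
    (h1 : IsOddInCoord 1 ρ₀) (h2 : IsEvenInCoord 0 ρ₀)
    (h3 : IsOddInCoord 0 (fun x => u₀ x 0)) (h4 : IsEvenInCoord 1 (fun x => u₀ x 0))
    (h5 : IsEvenInCoord 0 (fun x => u₀ x 1)) (h6 : IsOddInCoord 1 (fun x => u₀ x 1))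
    (h7 : ∀ x : EuclideanSpace ℝ (Fin 2), x 0 = 0 → x 1 ∈ Icc 0 π → 0 ≤ ρ₀ x)
    (h8 : ∃ x : EuclideanSpace ℝ (Fin 2), x 0 = 0 ∧ x 1 ∈ Icc 0 π ∧ 0 < ρ₀ x)
    (h9 : ∀ x : EuclideanSpace ℝ (Fin 2), x 0 = π → x 1 ∈ Icc 0 π → ρ₀ x ≤ 0)
    {u : ℝ → EuclideanSpace ℝ (Fin 2) → EuclideanSpace ℝ (Fin 2)}
    {p ρ : ℝ → EuclideanSpace ℝ (Fin 2) → ℝ}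
    (hsol : ∀ T : ℝ, IsClassicalBoussinesqOnPlane (Ico 0 T) u p ρ)
    (hper : ∀ t : ℝ, 0 ≤ t → IsDoublyPeriodic (2 * π) (u t) ∧ IsDoublyPeriodic (2 * π) (p t) ∧
      IsDoublyPeriodic (2 * π) (ρ t))
    (hu0 : u 0 = u₀) (hρ0 : ρ 0 = ρ₀) (B : ℝ) :
    ∃ τ : ℝ, 0 ≤ τ ∧ ∃ x : EuclideanSpace ℝ (Fin 2), B < ‖fderiv ℝ (ρ τ) x‖ := by
  obtain ⟨c, hc, hmain⟩ := h u₀ ρ₀ h1 h2 h3 h4 h5 h6 h7 h8 h9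
  -- choose t with c * √t ≥ B : t = (B/c)², so c √t = |B| ≥ B
  set t : ℝ := (B / c) ^ 2 with ht
  have ht0 : 0 ≤ t := sq_nonneg _
  have hsqrt : c * Real.sqrt t = |B| := by
    rw [ht, Real.sqrt_sq_eq_abs, abs_div, abs_of_pos hc, mul_div_cancel₀ _ hc.ne']
  obtain ⟨τ, hτ, x, hx⟩ := hmain (t + 1) u p ρ (hsol (t + 1))
    (fun s hs => hper s hs.1) hu0 hρ0 t ⟨ht0, lt_add_one t⟩
  exact ⟨τ, hτ.1, x, lt_of_le_of_lt (le_abs_self B) (hsqrt ▸ hx)⟩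

/-- **Reading of Theorem 1.4: on the strip the planar vorticity of a GLOBAL solution is unbounded in
time** (`‖ω(t)‖_∞ ≥ c t³` past the waiting time). [cite: KiselevParkYao2022, Theorem 1.4 (arXiv:2211.05070 p0005 L15–L33)] -/
theorem KiselevParkYao2022_stripGrowth.vorticity_unbounded_of_global
    (h : KiselevParkYao2022_stripGrowth)
    {u₀ : EuclideanSpace ℝ (Fin 2) → EuclideanSpace ℝ (Fin 2)} {ρ₀ : EuclideanSpace ℝ (Fin 2) → ℝ}
    (h1 : ∀ x ∈ closure (kpyStrip : Set (EuclideanSpace ℝ (Fin 2))),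
      ρ₀ (flipCoord 0 x) = ρ₀ x ∧ u₀ (flipCoord 0 x) 0 = -u₀ x 0 ∧ u₀ (flipCoord 0 x) 1 = u₀ x 1)
    (h2 : ∃ k₀ : ℝ, 0 < k₀ ∧ ∀ x : EuclideanSpace ℝ (Fin 2), x 0 = 0 → x 1 ∈ Icc 0 π → k₀ ≤ ρ₀ x)
    (h3 : ∀ x : EuclideanSpace ℝ (Fin 2), x 0 = π → x 1 ∈ Icc 0 π → ρ₀ x ≤ 0)
    {u : ℝ → EuclideanSpace ℝ (Fin 2) → EuclideanSpace ℝ (Fin 2)}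
    {p ρ : ℝ → EuclideanSpace ℝ (Fin 2) → ℝ}
    (hsol : ∀ T : ℝ, IsClassicalBoussinesqOnStrip (Ico 0 T) u p ρ)
    (hsu : ∀ T : ℝ, ContDiffOn ℝ ∞ (uncurry u)
      (Ico 0 T ×ˢ closure (kpyStrip : Set (EuclideanSpace ℝ (Fin 2)))))
    (hsp : ∀ T : ℝ, ContDiffOn ℝ ∞ (uncurry p)
      (Ico 0 T ×ˢ closure (kpyStrip : Set (EuclideanSpace ℝ (Fin 2)))))
    (hsρ : ∀ T : ℝ, ContDiffOn ℝ ∞ (uncurry ρ)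
      (Ico 0 T ×ˢ closure (kpyStrip : Set (EuclideanSpace ℝ (Fin 2)))))
    (hper : ∀ t : ℝ, 0 ≤ t → IsPeriodicInCoord 0 (2 * π) (u t) ∧ IsPeriodicInCoord 0 (2 * π) (p t) ∧
      IsPeriodicInCoord 0 (2 * π) (ρ t))
    (hu0 : u 0 = u₀) (hρ0 : ρ 0 = ρ₀) (B : ℝ) :
    ∃ t : ℝ, 0 ≤ t ∧ ∃ x ∈ kpyStrip, B < |curl2 (u t) x| := by
  obtain ⟨T₀, c, hT₀, hc, -, hmain⟩ := h u₀ ρ₀ h1 h2 h3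
  -- a time t ≥ max T₀ 1 with c t³ ≥ c t > B
  set t : ℝ := max T₀ (max 1 (B / c + 1)) with ht
  have hT₀t : T₀ ≤ t := le_max_left _ _
  have h1t : 1 ≤ t := le_trans (le_max_left _ _) (le_max_right _ _)
  have hBt : B < c * t := by
    have : B / c + 1 ≤ t := le_trans (le_max_right _ _) (le_max_right _ _)
    have hB : B = c * (B / c) := by field_simp
    rw [hB]
    exact mul_lt_mul_of_pos_left (by linarith) hc
  have ht3 : c * t ≤ c * t ^ 3 := by
    have h0 : 0 ≤ t := by linarith
    have hprod : 0 ≤ t * (t - 1) * (t + 1) :=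
      mul_nonneg (mul_nonneg h0 (by linarith)) (by linarith)
    exact mul_le_mul_of_nonneg_left (by nlinarith [hprod]) hc.le
  obtain ⟨hA, -⟩ := hmain (t + 1) u p ρ (hsol (t + 1)) (hsu (t + 1)) (hsp (t + 1)) (hsρ (t + 1))
    (fun s hs => hper s hs.1) hu0 hρ0
  obtain ⟨hω, -⟩ := hA t ⟨by linarith, lt_add_one t⟩ hT₀t
  obtain ⟨x, hx, hBx⟩ := hω B (lt_of_lt_of_le hBt ht3)
  exact ⟨t, by linarith, x, hx, hBx⟩

/-- **Reading of Theorem 1.7 for the zone sheet: in the mirror class WITH walls the angular vorticity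
of a GLOBAL smooth solution is unbounded in time** — so a uniform-in-time bound on `‖ω^θ‖_∞` is
incompatible with global smooth existence for such data. [cite: KiselevParkYao2022, Theorem 1.7 (arXiv:2211.05070 p0006 L37–L46)] -/
theorem KiselevParkYao2022_annulusSwirlGrowth.angularVorticity_unbounded_of_global
    (h : KiselevParkYao2022_annulusSwirlGrowth)
    {u₀ : EuclideanSpace ℝ (Fin 3) → EuclideanSpace ℝ (Fin 3)}
    (h1 : ∀ x ∈ closure (kpyAnnulus : Set (EuclideanSpace ℝ (Fin 3))),
      u₀ (reflectZ x) = reflectZ (u₀ x))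
    (h2 : ∃ k₀ : ℝ, 0 < k₀ ∧
      (∀ x ∈ closure (kpyAnnulus : Set (EuclideanSpace ℝ (Fin 3))), x 2 = π →
        k₀ ≤ swirlVelocity u₀ x) ∧
      (∀ x ∈ closure (kpyAnnulus : Set (EuclideanSpace ℝ (Fin 3))), x 2 = 0 →
        |swirlVelocity u₀ x| ≤ k₀ / 8))
    {u : ℝ → EuclideanSpace ℝ (Fin 3) → EuclideanSpace ℝ (Fin 3)}
    {p : ℝ → EuclideanSpace ℝ (Fin 3) → ℝ}
    (hsol : ∀ T : ℝ, IsClassicalEulerOnDomain (Ico 0 T) kpyAnnulus kpyAnnulusNormal 0 u p)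
    (hsu : ∀ T : ℝ, ContDiffOn ℝ ∞ (uncurry u)
      (Ico 0 T ×ˢ closure (kpyAnnulus : Set (EuclideanSpace ℝ (Fin 3)))))
    (hsp : ∀ T : ℝ, ContDiffOn ℝ ∞ (uncurry p)
      (Ico 0 T ×ˢ closure (kpyAnnulus : Set (EuclideanSpace ℝ (Fin 3)))))
    (hsym : ∀ t : ℝ, 0 ≤ t → IsAxisymmetric (u t) ∧ IsAxisymmetricScalar (p t) ∧
      IsAxiallyPeriodic (2 * π) (u t) ∧ IsAxiallyPeriodic (2 * π) (p t))
    (hu0 : u 0 = u₀) (B : ℝ) :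
    ∃ t : ℝ, 0 ≤ t ∧ ∃ x ∈ kpyAnnulus, B < |angularVorticity (u t) x| := by
  obtain ⟨T₀, c, hT₀, hc, -, hmain⟩ := h u₀ h1 h2
  set t : ℝ := max T₀ (max 1 (B / c + 1)) with ht
  have hT₀t : T₀ ≤ t := le_max_left _ _
  have h1t : 1 ≤ t := le_trans (le_max_left _ _) (le_max_right _ _)
  have hBt : B < c * t := by
    have : B / c + 1 ≤ t := le_trans (le_max_right _ _) (le_max_right _ _)
    have hB : B = c * (B / c) := by field_simp
    rw [hB]
    exact mul_lt_mul_of_pos_left (by linarith) hc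
  have ht3 : c * t ≤ c * t ^ 3 := by
    have h0 : 0 ≤ t := by linarith
    have hprod : 0 ≤ t * (t - 1) * (t + 1) :=
      mul_nonneg (mul_nonneg h0 (by linarith)) (by linarith)
    exact mul_le_mul_of_nonneg_left (by nlinarith [hprod]) hc.le
  obtain ⟨hω, -⟩ := hmain (t + 1) u p (hsol (t + 1)) (hsu (t + 1)) (hsp (t + 1))
    (fun s hs => hsym s hs.1) hu0 t ⟨by linarith, lt_add_one t⟩ hT₀t
  obtain ⟨x, hx, hBx⟩ := hω B (lt_of_lt_of_le hBt ht3)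
  exact ⟨t, by linarith, x, hx, hBx⟩

/-! ### The mirror class: the vorticity is a pseudovector (appended; proof-only)

The printed class of Theorem 1.7 is "`u^θ₀` even in `z`, `ω^θ₀` odd in `z`". The rendering
`IsMirrorSymmetricZ` (`u(Rx) = R u(x)`) was shown above to give `u^θ` even; here the remaining
half is PROVED: for a differentiable mirror-symmetric field the vorticity transforms as a
pseudovector, `curl u (Rx) = −R (curl u x)`, so the angular vorticity `ω^θ` is ODD in `z`. -/

/-- The reflection `z ↦ −z` is (the underlying map of) a continuous linear map
(`id − 2 e₂ ⊗ e₂*`), hence its own Fréchet derivative everywhere.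
[cite: KiselevParkYao2022, Theorem 1.7 parity hypotheses (arXiv:2211.05070 p0006 L43)] -/
theorem exists_clm_hasFDerivAt_reflectZ :
    ∃ L : EuclideanSpace ℝ (Fin 3) →L[ℝ] EuclideanSpace ℝ (Fin 3),
      (∀ y, L y = reflectZ y) ∧ ∀ x, HasFDerivAt reflectZ L x := by
  set L : EuclideanSpace ℝ (Fin 3) →L[ℝ] EuclideanSpace ℝ (Fin 3) :=
    ContinuousLinearMap.id ℝ (EuclideanSpace ℝ (Fin 3)) -
      (2 : ℝ) • ((EuclideanSpace.proj (2 : Fin 3) :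
        EuclideanSpace ℝ (Fin 3) →L[ℝ] ℝ).smulRight (eZ : EuclideanSpace ℝ (Fin 3))) with hL
  have hLy : ∀ y, L y = reflectZ y := fun y => by
    simp only [hL, reflectZ, FunLike.coe_sub, Pi.sub_apply,
      ContinuousLinearMap.id_apply, FunLike.coe_smul, Pi.smul_apply,
      ContinuousLinearMap.smulRight_apply, smul_smul]
    rfl
  refine ⟨L, hLy, fun x => ?_⟩
  have hfun : reflectZ = fun y => L y := funext fun y => (hLy y).symm
  rw [hfun]
  exact L.hasFDerivAt

/-- The reflection fixes `e₀`. [cite: KiselevParkYao2022, Theorem 1.7 parity hypotheses (arXiv:2211.05070 p0006 L43)] -/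
@[simp] theorem reflectZ_single_zero :
    reflectZ (EuclideanSpace.single (0 : Fin 3) (1 : ℝ)) = EuclideanSpace.single 0 1 := by
  ext i; fin_cases i <;> simp

/-- The reflection fixes `e₁`. [cite: KiselevParkYao2022, Theorem 1.7 parity hypotheses (arXiv:2211.05070 p0006 L43)] -/
@[simp] theorem reflectZ_single_one :
    reflectZ (EuclideanSpace.single (1 : Fin 3) (1 : ℝ)) = EuclideanSpace.single 1 1 := by
  ext i; fin_cases i <;> simp

/-- The reflection negates `e₂`. [cite: KiselevParkYao2022, Theorem 1.7 parity hypotheses (arXiv:2211.05070 p0006 L43)] -/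
@[simp] theorem reflectZ_single_two :
    reflectZ (EuclideanSpace.single (2 : Fin 3) (1 : ℝ)) = -EuclideanSpace.single 2 1 := by
  ext i; fin_cases i <;> simp

/-- A mirror-symmetric field is `R ∘ v ∘ R`: `v y = R (v (R y))`. [cite: KiselevParkYao2022, Theorem 1.7 parity hypotheses (arXiv:2211.05070 p0006 L43)] -/
theorem IsMirrorSymmetricZ.eq_reflectZ_comp {v : EuclideanSpace ℝ (Fin 3) → EuclideanSpace ℝ (Fin 3)}
    (hv : IsMirrorSymmetricZ v) (y : EuclideanSpace ℝ (Fin 3)) : v y = reflectZ (v (reflectZ y)) := by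
  rw [hv y, reflectZ_reflectZ]

/-- Differentiability is mirror-symmetric in the mirror class. [cite: KiselevParkYao2022, Theorem 1.7 parity hypotheses (arXiv:2211.05070 p0006 L43)] -/
theorem IsMirrorSymmetricZ.differentiableAt_reflectZ
    {v : EuclideanSpace ℝ (Fin 3) → EuclideanSpace ℝ (Fin 3)} (hv : IsMirrorSymmetricZ v)
    {x : EuclideanSpace ℝ (Fin 3)} (hd : DifferentiableAt ℝ v x) :
    DifferentiableAt ℝ v (reflectZ x) := by
  obtain ⟨L, -, hL⟩ := exists_clm_hasFDerivAt_reflectZ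
  have hfun : v = fun y => reflectZ (v (reflectZ y)) := funext hv.eq_reflectZ_comp
  rw [hfun]
  have hvR : DifferentiableAt ℝ v (reflectZ (reflectZ x)) := by rwa [reflectZ_reflectZ]
  have hcomp : DifferentiableAt ℝ (fun y => v (reflectZ y)) (reflectZ x) :=
    hvR.comp _ (hL _).differentiableAt
  exact (hL _).differentiableAt.comp _ hcomp

/-- **Chain rule in the mirror class**: `Dv(Rx) w = R (Dv(x) (R w))`. [cite: KiselevParkYao2022, Theorem 1.7 parity hypotheses (arXiv:2211.05070 p0006 L43)] -/
theorem IsMirrorSymmetricZ.fderiv_reflectZ_apply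
    {v : EuclideanSpace ℝ (Fin 3) → EuclideanSpace ℝ (Fin 3)} (hv : IsMirrorSymmetricZ v)
    {x : EuclideanSpace ℝ (Fin 3)} (hd : DifferentiableAt ℝ v x) (w : EuclideanSpace ℝ (Fin 3)) :
    fderiv ℝ v (reflectZ x) w = reflectZ (fderiv ℝ v x (reflectZ w)) := by
  obtain ⟨L, hLy, hL⟩ := exists_clm_hasFDerivAt_reflectZ
  have hdR : DifferentiableAt ℝ v (reflectZ x) := hv.differentiableAt_reflectZ hd
  -- derivative of `v ∘ R` and of `R ∘ v` at `x`
  have h1 : HasFDerivAt (fun y => v (reflectZ y)) ((fderiv ℝ v (reflectZ x)).comp L) x :=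
    hdR.hasFDerivAt.comp x (hL x)
  have h2 : HasFDerivAt (fun y => reflectZ (v y)) (L.comp (fderiv ℝ v x)) x :=
    (hL (v x)).comp x hd.hasFDerivAt
  have hfun : (fun y => v (reflectZ y)) = fun y => reflectZ (v y) := funext hv
  rw [hfun] at h1
  have heq : (fderiv ℝ v (reflectZ x)).comp L = L.comp (fderiv ℝ v x) := h1.unique h2
  have happ := congrArg (fun M : EuclideanSpace ℝ (Fin 3) →L[ℝ] EuclideanSpace ℝ (Fin 3) =>
    M (reflectZ w)) heq
  simp only [ContinuousLinearMap.coe_comp, Function.comp_apply, hLy, reflectZ_reflectZ] at happ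
  exact happ

/-- **The vorticity is a pseudovector under the mirror symmetry**: for a differentiable
mirror-symmetric field, `curl v (Rx) = −R (curl v x)` — the horizontal vorticity components are
odd and the axial one is even in `z`. [cite: KiselevParkYao2022, Theorem 1.7 parity hypotheses (arXiv:2211.05070 p0006 L43)] -/
theorem IsMirrorSymmetricZ.curl_reflectZ
    {v : EuclideanSpace ℝ (Fin 3) → EuclideanSpace ℝ (Fin 3)} (hv : IsMirrorSymmetricZ v)
    {x : EuclideanSpace ℝ (Fin 3)} (hd : DifferentiableAt ℝ v x) :
    curl v (reflectZ x) = -reflectZ (curl v x) := by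
  have hD := hv.fderiv_reflectZ_apply hd
  ext i
  fin_cases i <;> simp [curl, hD] <;> ring

/-- **In the mirror class the angular vorticity `ω^θ` is ODD in `z`** (the second printed parity
hypothesis of Theorem 1.7, here a consequence of `IsMirrorSymmetricZ` for differentiable fields).
[cite: KiselevParkYao2022, Theorem 1.7 parity hypotheses (arXiv:2211.05070 p0006 L43)] -/
theorem IsMirrorSymmetricZ.angularVorticity_reflectZ
    {v : EuclideanSpace ℝ (Fin 3) → EuclideanSpace ℝ (Fin 3)} (hv : IsMirrorSymmetricZ v)
    {x : EuclideanSpace ℝ (Fin 3)} (hd : DifferentiableAt ℝ v x) :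
    angularVorticity v (reflectZ x) = -angularVorticity v x := by
  rw [angularVorticity, angularVorticity, hv.curl_reflectZ hd, eTheta_reflectZ]
  simp only [eTheta, PiLp.inner_apply, RCLike.inner_apply, conj_trivial, Fin.sum_univ_three,
    PiLp.smul_apply, smul_eq_mul, PiLp.neg_apply, reflectZ_apply_zero, reflectZ_apply_one,
    reflectZ_apply_two, Matrix.cons_val_zero, Matrix.cons_val_one, Matrix.cons_val_two,
    Matrix.head_cons, Matrix.tail_cons]
  ring

/-- On the mirror plane `{z = 0}` the angular vorticity of a differentiable mirror-symmetric field
vanishes (`ω^θ` odd in `z`). [cite: KiselevParkYao2022, Theorem 1.7 parity hypotheses (arXiv:2211.05070 p0006 L43)] -/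
theorem IsMirrorSymmetricZ.angularVorticity_eq_zero_of_plane
    {v : EuclideanSpace ℝ (Fin 3) → EuclideanSpace ℝ (Fin 3)} (hv : IsMirrorSymmetricZ v)
    {x : EuclideanSpace ℝ (Fin 3)} (hd : DifferentiableAt ℝ v x) (hx : x 2 = 0) :
    angularVorticity v x = 0 := by
  have hfix : reflectZ x = x := by
    ext i; fin_cases i <;> simp [hx]
  have h := hv.angularVorticity_reflectZ hd
  rw [hfix] at h
  linarith

end Literature.Analysis.FluidPDE
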